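import Summits.ValiantsHypothesis.ValiantsHypothesis.Theorems.NewtonUnitEquationsTwoProductsRankOneThreeFreeLawCount
import HarnessLib

/-!
# Route NewtonUnitEquations — crux `TwoProducts` (stmt-ValiantsHypothesis-5906), line `relation_ladder`, rung R7a (three-term
# rank one, GENERAL shape `α = qβ + rγ`, `q, r ≥ 1`): the FREE LIFT with DOUBLE SLICING — `RankOneThreeFreeLaw` — part 6/6 — large/absent coefficients ⇒ permutation type; the arithmetic; the law `rankOneThreeFreeLaw_proof` (T8, end)

(T8, end) `msetT_apply_le` (≤ m copies of a letter per tuple), `permType_of_rankOne_largeCoeff` / `permType_of_rankOne_absent`, the arithmetic `arith_R7a` (c = 736) and the law, stated by its LITERAL body: `rankOneThreeFreeLaw_proof`.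

val-idea-8 g3 (ideator; lens decomp), 2026-08-28. Generalises the R6b module (`α = β + γ`, val-lit-p3 g15's port `…RankOneThreeLaw*`,
imported): the substitution `Y_α ↦ Y_β^q Y_γ^r` has fibres `{x + k(e_α − q e_β − r e_γ)}` of letter count `n_k = R + B_k`, `R = Σ_{rest} x_j`,
`B_k = x_β + x_γ − (q+r−1)k ≥ 0`; slicing BOTH relation coordinates `(b₁, b₂) = (x_β, x_γ)` makes `multinomial(L_k)/n_k = Pfac(x) ·
C(R + B_k − 1, B_k) · κ_k` EXACT with `Pfac = (R−1)!/∏_{rest} x_j!`, so the slice functions are R6b's with `(b − k) ↦ B_k` and no binomial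
character — finite SHIFT RANK, and val-lit-p3's `ShiftRank.pencilCount` applies BY NAME.  Large coefficients (`q > m` or `r > m`) force
permutation type (`msetT a e ≤ m`), handled by R3♯ `permTypeLaw_proof`.

PORT NOTE (val-lit-p3 g15, prover seat, helper mode `--supports stmt-ValiantsHypothesis-5906 --as helper`, no stub credit claimed; the
author's invitation val-width INBOX 11:42Z + desk RULING #279 (c)): part 6/6 of a VERBATIM Theorems-side port of val-idea-8 g3's sorry-free
module `Cruxes/TwoProducts/Lines/relation_ladder_R7a.lean` (tree @0a494ab61a34; sha256 2455bfd4f3ef04f6…; 1 627 lines; `lean check` rc 0,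
0 sorries, 0 warnings). ALL mathematics and ALL proofs are val-idea-8 g3's (engine memo `Lines/relation_ladder_R7_engine.md` rev 2 §7).  The
port changes only: (i) the file split and the import chain; (ii) declarations that the source re-declares VERBATIM from the landed R6b port
(`sum_sgn`, `HSD` + `HSD.mul/mulHom/homMul/constMul/sum/add`, `hsd_binChar`, `rW_pos`) or from the R6 port (`tab`, `sgn`, `rW`,
`toolBound_mono`) or from `…FormalLogLinearisationStubRaysRung` (`wt_nsmul'` = `wt_nsmul`) are NOT re-declared but referenced BY NAME
(`R6b.…` for the sibling namespace); (iii) the section variables are renamed `I ↦ Iq` (the `QIdx` datum) and `D ↦ Dq` (the `RelData`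
datum) — a pure α-renaming forced by the gate's statement-text index (`dedup.landed` keys on declaration text, namespace-blind, and
the R6b port owns same-text lemmas over `ThreeIdx`); (iv) one-line docstrings on API lemmas; (v) in part 6/6 the parameter-free
`def RankOneThreeFreeLaw : Prop` is NOT declared (relocation rule) — the law is stated by its LITERAL body as `rankOneThreeFreeLaw_proof`.
Namespace = the author's (`…PermutationType.R7a`).  Nothing here closes the line's residual, the crux `TwoProducts` (5906) or `VP ≠ VNP`;
no summit statement is proved.

Honest scope (the author's): relations with the lone letter carrying a coefficient `p ≥ 2` (e.g. `2β = α + γ` = R6c, `pβ = qα + rγ`), two-letter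
`pα = qβ`, support ≥ 4 and coincidence rank ≥ 2 are NOT covered here.  Nothing here moves VP ≠ VNP; `TwoProducts` (5906) stays OPEN. [folklore]
-/

noncomputable section

-- Sub = Summit single-conjunct layout: the duplicated namespace component is mandated by the tree.
set_option linter.dupNamespace false
set_option linter.unusedSimpArgs false
set_option linter.deprecated false
set_option linter.unusedSectionVars false
set_option linter.unusedVariables false
set_option linter.unnecessarySeqFocus false

namespace Summit.ValiantsHypothesis.ValiantsHypothesis.Theorems.NewtonUnitEquations.TwoProducts.PermutationType
namespace R7a
open scoped BigOperators
open MvPolynomial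

variable {σ : Type*} [Fintype σ] [DecidableEq σ]

variable (Iq : QIdx σ)

section FreeCount
open Summit.ValiantsHypothesis.ValiantsHypothesis.Theorems.NewtonUnitEquations.TwoProducts.FormalLogLinearisation
open Summit.ValiantsHypothesis.ValiantsHypothesis.Theorems.NewtonUnitEquations.TwoProducts.PlanarCell

variable {m : ℕ} {u v : Fin m → MvPolynomial (Fin 2) ℂ} (Dq : RelData u v)

/-! ### Degenerate relation data are permutation type -/

/-- A `0`-filled letter tuple of length `m` uses every letter at most `m` times. [folklore] -/
theorem msetT_apply_le (a : Fin m → Expo) (e : Expo) : msetT a e ≤ m := by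
  classical
  unfold msetT
  rw [Finsupp.finsetSum_apply]
  calc ∑ j, ((if a j = 0 then (0 : Expo →₀ ℕ) else Finsupp.single (a j) 1) e)
      ≤ ∑ _j : Fin m, 1 := Finset.sum_le_sum fun j _ => by
        split_ifs with h
        · simp
        · rw [Finsupp.single_apply]; split_ifs <;> simp
    _ = m := by simp

/-- **Large coefficients are permutation type.** If the coincidences are rank one with relation `ρ⁺ ~ ρ⁻` and some letter has
coefficient `> m` on one side and `0` on the other, the family is of permutation type. [folklore] -/
theorem permType_of_rankOne_largeCoeff (A : Fin m → Finset Expo) (ρp ρm : Expo →₀ ℕ) (e : Expo)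
    (h : RankOneCoincidences A ρp ρm) (hl : (m < ρp e ∧ ρm e = 0) ∨ (m < ρm e ∧ ρp e = 0)) : PermType A := by
  intro a ha b hb hab
  obtain ⟨k, hk⟩ := h a ha b hb hab
  have hae := msetT_apply_le a e
  have hbe := msetT_apply_le b e
  rcases Nat.eq_zero_or_pos k with rfl | hk0
  · rcases hk with hk | hk
    · simpa using hk
    · simpa using hk.symm
  · exfalso
    rcases hk with hk | hk
    · have h1 := congrArg (fun f : Expo →₀ ℕ => f e) hk
      simp only [Finsupp.add_apply, Finsupp.smul_apply, smul_eq_mul] at h1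
      rcases hl with ⟨hp, hm0⟩ | ⟨hm, hp0⟩
      · rw [hm0, mul_zero, add_zero] at h1
        have : ρp e ≤ k * ρp e := Nat.le_mul_of_pos_left _ hk0
        omega
      · rw [hp0, mul_zero, add_zero] at h1
        have : ρm e ≤ k * ρm e := Nat.le_mul_of_pos_left _ hk0
        omega
    · have h1 := congrArg (fun f : Expo →₀ ℕ => f e) hk
      simp only [Finsupp.add_apply, Finsupp.smul_apply, smul_eq_mul] at h1
      rcases hl with ⟨hp, hm0⟩ | ⟨hm, hp0⟩
      · rw [hm0, mul_zero, add_zero] at h1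
        have : ρp e ≤ k * ρp e := Nat.le_mul_of_pos_left _ hk0
        omega
      · rw [hp0, mul_zero, add_zero] at h1
        have : ρm e ≤ k * ρm e := Nat.le_mul_of_pos_left _ hk0
        omega

/-- **Absent relation letters are permutation type.** If a letter with positive coefficient on one side of the relation (and `0`
on the other) is absent from the family, rank-one coincidences are of permutation type. [folklore] -/
theorem permType_of_rankOne_absent (A : Fin m → Finset Expo) (ρp ρm : Expo →₀ ℕ) (e : Expo)
    (h : RankOneCoincidences A ρp ρm) (hl : (0 < ρp e ∧ ρm e = 0) ∨ (0 < ρm e ∧ ρp e = 0)) (hnot : ∀ j, e ∉ A j) :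
    PermType A := by
  intro a ha b hb hab
  obtain ⟨k, hk⟩ := h a ha b hb hab
  have hae := msetT_apply_eq_zero A a ha e hnot
  have hbe := msetT_apply_eq_zero A b hb e hnot
  rcases Nat.eq_zero_or_pos k with rfl | hk0
  · rcases hk with hk | hk
    · simpa using hk
    · simpa using hk.symm
  · exfalso
    rcases hk with hk | hk
    · have h1 := congrArg (fun f : Expo →₀ ℕ => f e) hk
      simp only [Finsupp.add_apply, Finsupp.smul_apply, smul_eq_mul, hae, hbe, zero_add] at h1
      rcases hl with ⟨hp, hm0⟩ | ⟨hm, hp0⟩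
      · rw [hm0, mul_zero] at h1
        have : ρp e ≤ k * ρp e := Nat.le_mul_of_pos_left _ hk0
        omega
      · rw [hp0, mul_zero] at h1
        have : ρm e ≤ k * ρm e := Nat.le_mul_of_pos_left _ hk0
        omega
    · have h1 := congrArg (fun f : Expo →₀ ℕ => f e) hk
      simp only [Finsupp.add_apply, Finsupp.smul_apply, smul_eq_mul, hae, hbe, zero_add] at h1
      rcases hl with ⟨hp, hm0⟩ | ⟨hm, hp0⟩
      · rw [hm0, mul_zero] at h1
        have : ρp e ≤ k * ρp e := Nat.le_mul_of_pos_left _ hk0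
        omega
      · rw [hp0, mul_zero] at h1
        have : ρm e ≤ k * ρm e := Nat.le_mul_of_pos_left _ hk0
        omega

/-! ### The arithmetic (no `ring` on numeral powers of `s + 2`) -/

/-- `Nm7_add_two_le` — technical lemma of the R7a free-lift toolkit (val-idea-8 g3). [folklore] -/
theorem Nm7_add_two_le (m : ℕ) (hm : 1 ≤ m) : Nm7 m + 2 ≤ 8 * (m + 1) ^ 5 := by
  unfold Nm7
  have e1 : (m + 1) ^ 2 = m * m + 2 * m + 1 := by ring
  have h1 : 2 * (m * m + m) + 1 ≤ 2 * (m + 1) ^ 2 := by rw [e1]; omega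
  have h2 : (2 * (m * m + m) + 1) ^ 2 ≤ (2 * (m + 1) ^ 2) ^ 2 := Nat.pow_le_pow_left h1 2
  have e3 : (2 * (m + 1) ^ 2) ^ 2 = 4 * (m + 1) ^ 4 := by ring
  rw [e3] at h2
  have h4 : 2 * m * (2 * (m * m + m) + 1) ^ 2 ≤ 2 * m * (4 * (m + 1) ^ 4) := Nat.mul_le_mul_left _ h2
  have e5 : 8 * (m + 1) ^ 5 = 2 * m * (4 * (m + 1) ^ 4) + 8 * (m + 1) ^ 4 := by ring
  have h6 : 1 ≤ (m + 1) ^ 4 := Nat.one_le_pow _ _ (by omega)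
  rw [e5]
  omega

/-- `Nm7_add_two_lt` — technical lemma of the R7a free-lift toolkit (val-idea-8 g3). [folklore] -/
theorem Nm7_add_two_lt (m : ℕ) (hm : 1 ≤ m) : Nm7 m + 2 < 2 ^ (5 * Nat.log 2 (m + 1) + 8) := by
  have hp1 : m + 1 < 2 ^ (Nat.log 2 (m + 1) + 1) := Nat.lt_pow_succ_log_self (by norm_num) (m + 1)
  have h5 : (m + 1) ^ 5 < (2 ^ (Nat.log 2 (m + 1) + 1)) ^ 5 := Nat.pow_lt_pow_left hp1 (by norm_num)
  have e3 : 8 * (2 ^ (Nat.log 2 (m + 1) + 1)) ^ 5 = 2 ^ (5 * Nat.log 2 (m + 1) + 8) := by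
    rw [← pow_mul, show (8 : ℕ) = 2 ^ 3 by norm_num, ← pow_add]
    congr 1
    ring
  have h1 := Nm7_add_two_le m hm
  have h8 : 8 * (m + 1) ^ 5 < 8 * (2 ^ (Nat.log 2 (m + 1) + 1)) ^ 5 := Nat.mul_lt_mul_of_pos_left h5 (by norm_num)
  omega

/-- `logNm7_le` — technical lemma of the R7a free-lift toolkit (val-idea-8 g3). [folklore] -/
theorem logNm7_le (m : ℕ) (hm : 1 ≤ m) : Nat.log 2 (Nm7 m + 2) + 1 ≤ 5 * Nat.log 2 (m + 1) + 8 := by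
  have := Nat.log_lt_of_lt_pow (by omega : Nm7 m + 2 ≠ 0) (Nm7_add_two_lt m hm)
  omega

/-- `sqlog7_le` — technical lemma of the R7a free-lift toolkit (val-idea-8 g3). [folklore] -/
theorem sqlog7_le (m : ℕ) (hm : 1 ≤ m) :
    (5 * Nat.log 2 (m + 1) + 8) * (5 * Nat.log 2 (m + 1) + 8) ≤ 244 * m := by
  have hp2 : 2 ^ Nat.log 2 (m + 1) ≤ m + 1 := Nat.pow_log_le_self 2 (by omega)
  have hpp : Nat.log 2 (m + 1) < 2 ^ Nat.log 2 (m + 1) := Nat.lt_two_pow_self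
  have hp3 : Nat.log 2 (m + 1) * Nat.log 2 (m + 1) ≤ 2 ^ (Nat.log 2 (m + 1) + 1) := sq_le_two_pow_succ _
  have h2p : 2 ^ (Nat.log 2 (m + 1) + 1) = 2 * 2 ^ Nat.log 2 (m + 1) := pow_succ' 2 _
  have e4 : (5 * Nat.log 2 (m + 1) + 8) * (5 * Nat.log 2 (m + 1) + 8) =
      25 * (Nat.log 2 (m + 1) * Nat.log 2 (m + 1)) + 80 * Nat.log 2 (m + 1) + 64 := by ring
  rw [e4]
  omega

/-- `powNm7_le` — technical lemma of the R7a free-lift toolkit (val-idea-8 g3). [folklore] -/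
theorem powNm7_le (m : ℕ) (hm : 1 ≤ m) : (Nm7 m + 2) ^ (3 * (Nat.log 2 (Nm7 m + 2) + 1)) ≤ 2 ^ (732 * m) := by
  have hN2 := Nm7_add_two_lt m hm
  have hL := logNm7_le m hm
  have hq := sqlog7_le m hm
  calc (Nm7 m + 2) ^ (3 * (Nat.log 2 (Nm7 m + 2) + 1))
      ≤ (2 ^ (5 * Nat.log 2 (m + 1) + 8)) ^ (3 * (Nat.log 2 (Nm7 m + 2) + 1)) := Nat.pow_le_pow_left hN2.le _
    _ ≤ (2 ^ (5 * Nat.log 2 (m + 1) + 8)) ^ (3 * (5 * Nat.log 2 (m + 1) + 8)) :=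
        Nat.pow_le_pow_right (by positivity) (Nat.mul_le_mul_left _ hL)
    _ = 2 ^ (3 * ((5 * Nat.log 2 (m + 1) + 8) * (5 * Nat.log 2 (m + 1) + 8))) := by
        rw [← pow_mul]
        congr 1
        ring
    _ ≤ 2 ^ (732 * m) := Nat.pow_le_pow_right (by norm_num) (by omega)

/-- `slices_le` — technical lemma of the R7a free-lift toolkit (val-idea-8 g3). [folklore] -/
theorem slices_le (m : ℕ) : (m * m + m + 1) * (m * m + m + 1) ≤ 2 ^ (4 * m) := by
  have hm1 : m + 1 ≤ 2 ^ m := Nat.lt_two_pow_self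
  have e1 : (m + 1) * (m + 1) = m * m + 2 * m + 1 := by ring
  have h1 : m * m + m + 1 ≤ (m + 1) * (m + 1) := by rw [e1]; omega
  have h2 : (m + 1) * (m + 1) ≤ 2 ^ m * 2 ^ m := Nat.mul_le_mul hm1 hm1
  have e2 : 2 ^ m * 2 ^ m * (2 ^ m * 2 ^ m) = 2 ^ (4 * m) := by
    rw [← pow_add, ← pow_add]
    congr 1
    ring
  calc (m * m + m + 1) * (m * m + m + 1) ≤ (2 ^ m * 2 ^ m) * (2 ^ m * 2 ^ m) :=
        Nat.mul_le_mul (h1.trans h2) (h1.trans h2)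
    _ = 2 ^ (4 * m) := e2

set_option exponentiation.threshold 1024 in
/-- **Arithmetic**: `(m²+m+1)² · sliceBd7 ≤ 2^{c m} (s+2)^c` and `2^{13m}(s+2)^2 ≤ 2^{c m}(s+2)^c` with `c = 736`. [folklore] -/
theorem arith_R7a : ∃ c : ℕ,
    (∀ m s : ℕ, 1 ≤ m → (m * m + m + 1) * (m * m + m + 1) * sliceBd7 m s ≤ 2 ^ (c * m) * (s + 2) ^ c) ∧
    (∀ m s : ℕ, 2 ^ (13 * m) * (s + 2) ^ 2 ≤ 2 ^ (c * m) * (s + 2) ^ c) := by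
  refine ⟨736, fun m s hm => ?_, fun m s => ?_⟩
  · have hsl := slices_le m
    have hsA : (s + 2) ^ 3 ≤ (s + 2) ^ 736 := Nat.pow_le_pow_right (by omega) (by norm_num)
    have hpow := powNm7_le m hm
    have h2m : 2 ^ (4 * m) * 2 ^ (732 * m) ≤ 2 ^ (736 * m) := by
      rw [← pow_add]
      exact Nat.pow_le_pow_right (by norm_num) (by omega)
    unfold sliceBd7
    calc (m * m + m + 1) * (m * m + m + 1) * ((s + 2) ^ 3 * (Nm7 m + 2) ^ (3 * (Nat.log 2 (Nm7 m + 2) + 1)))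
        ≤ 2 ^ (4 * m) * ((s + 2) ^ 736 * 2 ^ (732 * m)) := Nat.mul_le_mul hsl (Nat.mul_le_mul hsA hpow)
      _ = 2 ^ (4 * m) * 2 ^ (732 * m) * (s + 2) ^ 736 := by
          rw [Nat.mul_comm ((s + 2) ^ 736) (2 ^ (732 * m)), ← Nat.mul_assoc]
      _ ≤ 2 ^ (736 * m) * (s + 2) ^ 736 := Nat.mul_le_mul_right _ h2m
  · exact Nat.mul_le_mul (Nat.pow_le_pow_right (by norm_num) (by omega))
      (Nat.pow_le_pow_right (by omega) (by norm_num))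


omit [Fintype σ] [DecidableEq σ] in
/-- **R7a — THE FREE THREE-LETTER RANK-ONE LAW (all coefficients), UNCONDITIONAL** (val-idea-8 g3's `rankOneThreeFreeLaw :
RankOneThreeFreeLaw` — free lift `Y_α ↦ Y_β^q Y_γ^r` + toric Lemma A + DOUBLE slicing `(x_β, x_γ)` + coefficient theorem with two varying
letter counts + finite shift rank + val-lit-p3's `ShiftRank.pencilCount`; large or absent coefficients are permutation type).  If ALL additive
coincidences of the letter family come from ONE relation `α = q β + r γ` (`q, r ≥ 1`) among distinct letters, then GLOBALLY
`#visible ≤ 2^{c m} (#T + 2)^c`; `q = r = 1` is R6b.  PORT DELTA (val-lit-p3 g15, filing seat): the source states this as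
`def RankOneThreeFreeLaw : Prop := …` + `theorem rankOneThreeFreeLaw : RankOneThreeFreeLaw`; parameter-free `def … : Prop`s are relocated by
the gate, so the law is stated by its LITERAL body and proved outright (a line file wires its own def against this theorem by `exact`).  Nothing
here closes the residual of the line, the crux `TwoProducts` (5906) or `VP ≠ VNP`. [folklore] -/
theorem rankOneThreeFreeLaw_proof :
  ∃ c : ℕ, ∀ (m : ℕ) (u v : Fin m → MvPolynomial (Fin 2) ℂ), (∀ j, coeff 0 (u j) = 0) → (∀ j, coeff 0 (v j) = 0) →
    (∃ (α β γ : Expo) (q r : ℕ), 1 ≤ q ∧ 1 ≤ r ∧ α ≠ β ∧ α ≠ γ ∧ β ≠ γ ∧ α = q • β + r • γ ∧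
      RankOneCoincidences (fun j => (u j).support ∪ (v j).support)
        (Finsupp.single β q + Finsupp.single γ r) (Finsupp.single α 1)) →
    ∀ S : Finset Expo, (∀ l ∈ S, ∃ ξ : Fin 2 → ℝ, ValidWeight u v ξ ∧ IsStrictTop ξ ↑(tailDiff u v).support l) →
      S.card ≤ 2 ^ (c * m) * ((tailSupport u v).card + 2) ^ c := by

  classical
  obtain ⟨c, hc1, hc2⟩ := arith_R7a
  refine ⟨c, fun m u v hu hv hrel S hS => ?_⟩
  obtain ⟨α, β, γ, q, r, hq, hr, hab, hac, hbc, hrel, hR⟩ := hrel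
  rcases S.eq_empty_or_nonempty with hSe | hSne
  · simp [hSe]
  obtain ⟨l₀, hl₀⟩ := hSne
  obtain ⟨ξ₀, hval₀, htop₀⟩ := hS l₀ hl₀
  have hm : 1 ≤ m := by
    rcases Nat.eq_zero_or_pos m with h | h
    · exfalso
      subst h
      apply mem_support_iff.mp htop₀.1
      unfold tailDiff
      simp
    · exact h
  -- evaluations of the relation sides at the three letters
  have hρpα : (Finsupp.single β q + Finsupp.single γ r) α = 0 := by
    simp [Finsupp.single_apply, Ne.symm hab, Ne.symm hac]
  have hρmα : (Finsupp.single α 1 : Expo →₀ ℕ) α = 1 := by simp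
  have hρpβ : (Finsupp.single β q + Finsupp.single γ r) β = q := by
    simp [Finsupp.single_apply, Ne.symm hbc]
  have hρmβ : (Finsupp.single α 1 : Expo →₀ ℕ) β = 0 := by simp [Finsupp.single_apply, hab]
  have hρpγ : (Finsupp.single β q + Finsupp.single γ r) γ = r := by
    simp [Finsupp.single_apply, hbc]
  have hρmγ : (Finsupp.single α 1 : Expo →₀ ℕ) γ = 0 := by simp [Finsupp.single_apply, hac]
  have hPT : PermType (fun j => (u j).support ∪ (v j).support) →
      S.card ≤ 2 ^ (c * m) * ((tailSupport u v).card + 2) ^ c := fun hperm =>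
    calc S.card ≤ 2 ^ (13 * m) * ((tailSupport u v).card + 2) ^ 2 := permTypeLaw_proof m u v hu hv hperm S hS
      _ ≤ 2 ^ (c * m) * ((tailSupport u v).card + 2) ^ c := hc2 m _
  by_cases hlarge : m < q ∨ m < r
  · -- a coefficient exceeds `m`: permutation type
    apply hPT
    rcases hlarge with hql | hrl
    · exact permType_of_rankOne_largeCoeff _ _ _ β hR (Or.inl ⟨by rw [hρpβ]; exact hql, hρmβ⟩)
    · exact permType_of_rankOne_largeCoeff _ _ _ γ hR (Or.inl ⟨by rw [hρpγ]; exact hrl, hρmγ⟩)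
  have hqm : q ≤ m := by omega
  have hrm : r ≤ m := by omega
  by_cases hall : α ∈ tailSupport u v ∧ β ∈ tailSupport u v ∧ γ ∈ tailSupport u v
  · obtain ⟨hα, hβ, hγ⟩ := hall
    let Dq : RelData u v := ⟨α, β, γ, q, r, hq, hr, hα, hβ, hγ, hab, hac, hbc, hrel⟩
    have h := (Dq.count hu hv hqm hrm hR S hS).trans (hc1 m (sE u v) hm)
    exact h
  · -- an absent relation letter: permutation type
    apply hPT
    have hex : ∃ e : Expo, (e = α ∨ e = β ∨ e = γ) ∧ e ∉ tailSupport u v := by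
      simp only [not_and_or] at hall
      rcases hall with h | h | h
      exacts [⟨α, Or.inl rfl, h⟩, ⟨β, Or.inr (Or.inl rfl), h⟩, ⟨γ, Or.inr (Or.inr rfl), h⟩]
    obtain ⟨e, he, hnot⟩ := hex
    have hnotj : ∀ j, e ∉ (u j).support ∪ (v j).support := by
      intro j hj
      apply hnot
      rcases Finset.mem_union.mp hj with h | h
      · exact support_u_subset u v j h
      · exact support_v_subset u v j h
    rcases he with rfl | rfl | rfl
    · exact permType_of_rankOne_absent _ _ _ e hR (Or.inr ⟨by rw [hρmα]; exact Nat.one_pos, hρpα⟩) hnotj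
    · exact permType_of_rankOne_absent _ _ _ e hR (Or.inl ⟨by rw [hρpβ]; exact hq, hρmβ⟩) hnotj
    · exact permType_of_rankOne_absent _ _ _ e hR (Or.inl ⟨by rw [hρpγ]; exact hr, hρmγ⟩) hnotj

end FreeCount

end R7a
end Summit.ValiantsHypothesis.ValiantsHypothesis.Theorems.NewtonUnitEquations.TwoProducts.PermutationType

end
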